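import Literature.MathematicalPhysics.QuantumFieldTheory.U1WardIdentity
import Literature.MathematicalPhysics.QuantumFieldTheory.LatticeGaugeProofs
import Summits.QuantumFields.YangMills.Theorems.UnitScaleGibbsMGFGronwall
import Summits.QuantumFields.YangMills.Theorems.UnitScaleGibbsMGFSecondMoment
import HarnessLib

/-!
# Gross's Gaussian domination (CMP 92, Thm 2.2) for Wilson `U(1)` lattice gauge theory on a torus —
# the decided abelian sibling of LINE 28 «gross-sd-transfer» (crux `HistoryTailL`, stmt-QuantumFields-19936)

Cell `ym3-torus` (YM ladder rung R3 = continuum SU(2) Yang–Mills on T³ — a RUNG, NOT the Clay problem: not d = 4, not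
infinite volume, not a mass gap); WIDTH helper seat `ym3-torus-px8` g9.  Helper `--supports stmt-QuantumFields-19936`;
THEOREMS ONLY (0 `def`, 0 `sorry`, default heartbeats); imports lit ✓`U1WardIdentity` (phase flows, plaquette charges, the
torus Ward identity), lit ✓`LatticeGaugeProofs` (the Wilson state is a probability measure) and ✓`UnitScaleGibbsMGFGronwall`
(ym-ust-19936-w8 g9's (α) letters: derivative of the MGF under the integral, Gross's Grönwall step, Chernoff) and ✓`UnitScaleGibbsMGFSecondMoment`
(ym3-torus-px9 g9's (β) letters: the `t → 0⁺` second-moment extraction) — all BY NAME.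

THE THEOREM (L. Gross, *Convergence of U(1)₃ lattice gauge theory to its continuum limit*, CMP 92 (1983) 137–162, Thm 2.2
«Gaussian Domination» with Lemma 4.1 «Schwinger–Dyson equations», proof §4 p. 153; here at lattice spacing `a = 1`, for the
WILSON energy `h(x) = 1 − cos x` (so `h″ ≤ α := 1`), on the PERIODIC torus `(ℤ∕L)^d` and for INTEGER 1-cochains `c`).  For an
exact 2-cochain `φ = dc` the flux functional `F(φ)(θ) = Σ_p φ(p)·h′(dθ(p)) = Σ_p (dc)_p · sin θ_p` is sub-Gaussian under the
Wilson state `⟨·⟩_β` with the FREE (lattice-Maxwell) variance proxy `‖φ‖²∕β`: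

  `⟨exp(s·F(dc))⟩_β ≤ exp(s²·‖dc‖²∕(2β))`  for every real `s`, every `β > 0`, every `d`, `L`, `c`   (★ `integral_exp_mul_flux_le`).

In the tree's letters: `F(dc) = U1WardIdentity.actionFlowDeriv c` (`= Σ_p (plaqCharge c p)·Im U_p`, the derivative of the
Wilson action along the phase flow `phaseFlow c`, token for token) and `‖dc‖² = Σ_p (plaqCharge c p)²`.
PROOF = print §4 verbatim, by name: `ψ(s) := ∫ e^{sF} dμ_β`; the torus Ward identity ✓`u1_torus_ward_identity c β` with
`F := e^{sF(dc)}` gives `β·∫ F(dc)·e^{sF(dc)} dμ_β = s·∫ e^{sF(dc)}·(Σ_p (dc)_p²·cos θ_p) dμ_β ≤ s·‖dc‖²·∫ e^{sF(dc)} dμ_β`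
(`cos ≤ 1`: lit `abs_re_le_one`) — this is (α)'s differential inequality with rate `a = ‖dc‖²∕β` and defect `Δ = 0`
(★★ `integral_flux_mul_exp_le`); (α)'s `hasDerivAt_integral_exp_mul_weight` + `le_mul_exp_of_deriv_le_linear_mul_of_mem` close
the Grönwall step for `s ≥ 0`, and `c ↦ −c` (`actionFlowDeriv_neg`) gives `s ≤ 0`.  COROLLARY (α)'s `measureReal_le_of_gronwall`:
the sub-Gaussian TAIL ★`measureReal_flux_ge_le` `μ_β{θ ≤ F(dc)} ≤ exp(−sθ + s²‖dc‖²∕(2β))` (`s ≥ 0`) and its optimised form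
★`measureReal_flux_ge_le_opt` `μ_β{θ ≤ F(dc)} ≤ exp(−β·θ²∕(2‖dc‖²))` (`θ ≥ 0`, `dc ≠ 0`).  §4 (appended on
✓(β)): the FREE VARIANCE BOUND ★★`integral_flux_sq_le` `∫ F(dc)² dμ_β ≤ ‖dc‖²∕β` (Gross Thm 2.5 I at `n = 1`) = ym3-torus-px9 g9's (β)
`integral_sq_mul_weight_le_of_subgaussian_mgf_nhds` on Thm 2.2 at `±t`, and `wilsonExpectation_flux_sq_le`.

WHY THE CELL WANTS IT.  The crux idea `Cruxes/HistoryTailL/Ideas/gross-sd-transfer.md` (ideator ym-r3-idea-2 g15) transplants exactly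
this identity-plus-Grönwall argument to SU(2) at the finest level with a covariantly exact test form; its card names the U(1)
statement «a theorem in print (Gross Thm 2.2), NOT in the tree» as the line's decided sibling.  This file makes the sibling a
kernel theorem with ZERO hypotheses: S_SD ⊕ S_dom ⊕ assembly of the line run end to end in U(1) — the four non-abelian defects
(i) covariant box Poincaré, (ii′) divergence of the `U`-dependent test field, (iii) Bianchi∕commutator, (iv) linearisation are
precisely what is ABSENT here (the test field is the constant cochain `c`, `X_c S = F(dc)` exactly, and `X_c F(dc) = Σ (dc)_p² cos θ_p`).

HONEST SCOPE.  An abelian (`U(1)`) theorem, in print since 1983, typed in the tree's finite-volume periodic vocabulary for integer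
cochains.  TODO(general form): Gross states Thm 2.2 for real finitely supported exact cochains on `ℤ^d`, general energies `h` with
A1–A3 and `h″ ≤ α`, and translation-invariant infinite-volume Gibbs states (via DLR); none of that generality is typed here.  It
proves NOTHING about SU(2): S_dom ∕ «BlockSecondMomentL» ∕ (Q) ∕ K1 ∕ `MeanDeviationL` ∕ `HistoryTailL` ∕ any crux or rung statement
is NOT proved or claimed.  YM₃ on T³ is rung R3, not Clay; YM gap NOT proved; no summit statement is proved here.
-/

set_option autoImplicit false

noncomputable section

open scoped BigOperators
open MeasureTheory Set Filter
open Literature.MathematicalPhysics.QuantumFieldTheory Literature.MathematicalPhysics.QuantumLattice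
open Summit.QuantumFields.YangMills.Theorems.UnitScaleGibbsMGFGronwall
open Summit.QuantumFields.YangMills.Theorems.UnitScaleGibbsMGFSecondMoment

namespace Summit.QuantumFields.YangMills.Theorems.U1TorusFluxGaussianDomination

variable {d L : ℕ}

/-! ## §1 The flux functional `F(dc) = actionFlowDeriv c` and its derivative along its own flow -/

/-- Charges are odd: `plaqCharge (−c) = −plaqCharge c`. [folklore] -/
theorem plaqCharge_neg (c : Edge d L → ℤ) (x : Site d L) (i j : Fin d) :
    plaqCharge (-c) x i j = -plaqCharge c x i j := by
  simp only [plaqCharge, Pi.neg_apply]; ring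

/-- The flux functional is odd in the cochain: `F(d(−c)) = −F(dc)`. [folklore] -/
theorem actionFlowDeriv_neg [NeZero L] (c : Edge d L → ℤ) (U : GaugeConfig d L Circle) :
    actionFlowDeriv (-c) U = -actionFlowDeriv c U := by
  simp only [actionFlowDeriv, plaqCharge_neg, Int.cast_neg, neg_mul, Finset.sum_neg_distrib]

/-- `|F(dc)(U)| ≤ Σ_p |(dc)_p|` (each `|Im U_p| ≤ 1`). [folklore] -/
theorem abs_actionFlowDeriv_le [NeZero L] (c : Edge d L → ℤ) (U : GaugeConfig d L Circle) :
    |actionFlowDeriv c U| ≤ ∑ p : Plaquette d L, |(plaqCharge c p.1 p.2.1.1 p.2.1.2 : ℝ)| := by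
  unfold actionFlowDeriv
  refine (Finset.abs_sum_le_sum_abs _ _).trans (Finset.sum_le_sum fun p _ => ?_)
  rw [abs_mul]
  exact (mul_le_mul_of_nonneg_left (abs_im_le_one _) (abs_nonneg _)).trans_eq (mul_one _)

/-- ★ The derivative of the flux functional along its own phase flow: `d∕dt F(dc)(φ_t U) = Σ_p (dc)_p² · Re (φ_t U)_p`
(`X_c F(dc) = Σ_p (dc)_p² cos θ_p` — Gross's `(φ, φ·h″(F))` with `h″ = cos`). [cite: GrossCMP1983, §4 (4.6)] -/
theorem hasDerivAt_actionFlowDeriv_phaseFlow [NeZero L] (c : Edge d L → ℤ) (U : GaugeConfig d L Circle) (t : ℝ) :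
    HasDerivAt (fun s => actionFlowDeriv c (phaseFlow c s U))
      (∑ p : Plaquette d L, (plaqCharge c p.1 p.2.1.1 p.2.1.2 : ℝ) ^ 2 *
        ((plaquetteHolonomy (phaseFlow c t U) p.1 p.2.1.1 p.2.1.2 : Circle) : ℂ).re) t := by
  simp only [actionFlowDeriv, plaquetteHolonomy_phaseFlow]
  refine HasDerivAt.fun_sum fun p _ => ?_
  have h := hasDerivAt_coe_exp_mul_im (plaqCharge c p.1 p.2.1.1 p.2.1.2 : ℝ)
    (plaquetteHolonomy U p.1 p.2.1.1 p.2.1.2) t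
  refine (h.const_mul (plaqCharge c p.1 p.2.1.1 p.2.1.2 : ℝ)).congr_deriv ?_
  ring

/-- The flow derivative of the flux is bounded by `‖dc‖² = Σ_p (dc)_p²` (`cos θ_p ≤ 1`). [cite: GrossCMP1983, §4 p. 153 «using h″(x) ≤ α»] -/
theorem sum_sq_mul_re_le [NeZero L] (c : Edge d L → ℤ) (U : GaugeConfig d L Circle) :
    ∑ p : Plaquette d L, (plaqCharge c p.1 p.2.1.1 p.2.1.2 : ℝ) ^ 2 *
        ((plaquetteHolonomy U p.1 p.2.1.1 p.2.1.2 : Circle) : ℂ).re ≤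
      ∑ p : Plaquette d L, (plaqCharge c p.1 p.2.1.1 p.2.1.2 : ℝ) ^ 2 := by
  refine Finset.sum_le_sum fun p _ => ?_
  have h1 : ((plaquetteHolonomy U p.1 p.2.1.1 p.2.1.2 : Circle) : ℂ).re ≤ 1 := (abs_le.1 (abs_re_le_one _)).2
  nlinarith [sq_nonneg (plaqCharge c p.1 p.2.1.1 p.2.1.2 : ℝ)]

/-- The flow derivative of the flux is continuous in the configuration. [folklore] -/
theorem continuous_sum_sq_mul_re [NeZero L] (c : Edge d L → ℤ) :
    Continuous fun U : GaugeConfig d L Circle => ∑ p : Plaquette d L, (plaqCharge c p.1 p.2.1.1 p.2.1.2 : ℝ) ^ 2 *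
        ((plaquetteHolonomy U p.1 p.2.1.1 p.2.1.2 : Circle) : ℂ).re := by
  refine continuous_finsetSum _ fun p _ => continuous_const.mul ?_
  exact Complex.continuous_re.comp (continuous_subtype_val.comp (u1PlaqChar p.1 p.2.1.1 p.2.1.2).continuous)

/-! ## §2 The Schwinger–Dyson differential inequality for `ψ(s) = ∫ e^{s·F(dc)} dμ_β` (Gross's (4.6) ⟹ `βψ′ ≤ s‖dc‖²ψ`) -/

section Torus

variable [NeZero L]

/-- ★★ **GROSS'S SCHWINGER–DYSON IDENTITY FOR THE FLUX MGF.** For every `β`, `c`, `s`: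
`β · ∫ F(dc)·e^{s·F(dc)} dμ_β = s · ∫ e^{s·F(dc)} · (Σ_p (dc)_p² cos θ_p) dμ_β` — the torus Ward identity ✓`u1_torus_ward_identity` with the
observable `e^{s·F(dc)}` along the flow `phaseFlow c` (whose action derivative IS `F(dc)`). [cite: GrossCMP1983, Lemma 4.1 + (4.6)] -/
theorem integral_flux_mul_exp_eq (c : Edge d L → ℤ) (β s : ℝ) :
    β * ∫ U, actionFlowDeriv c U * Real.exp (s * actionFlowDeriv c U) ∂(wilsonMeasure u1Rep β) =
      s * ∫ U, Real.exp (s * actionFlowDeriv c U) *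
        (∑ p : Plaquette d L, (plaqCharge c p.1 p.2.1.1 p.2.1.2 : ℝ) ^ 2 *
          ((plaquetteHolonomy U p.1 p.2.1.1 p.2.1.2 : Circle) : ℂ).re) ∂(wilsonMeasure u1Rep β) := by
  have hX := continuous_actionFlowDeriv (d := d) (L := L) c
  have hY := continuous_sum_sq_mul_re (d := d) (L := L) c
  have hF : Continuous fun U : GaugeConfig d L Circle => Real.exp (s * actionFlowDeriv c U) :=
    Real.continuous_exp.comp (continuous_const.mul hX)
  have hward := u1_torus_ward_identity (d := d) (L := L) c β
    (F := fun U => Real.exp (s * actionFlowDeriv c U))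
    (XF := fun U => Real.exp (s * actionFlowDeriv c U) *
      (s * ∑ p : Plaquette d L, (plaqCharge c p.1 p.2.1.1 p.2.1.2 : ℝ) ^ 2 *
        ((plaquetteHolonomy U p.1 p.2.1.1 p.2.1.2 : Circle) : ℂ).re))
    hF (hF.mul (continuous_const.mul hY)) fun U t =>
      (((hasDerivAt_actionFlowDeriv_phaseFlow c U t).const_mul s).exp).congr_deriv (by ring)
  simp only [wilsonExpectation] at hward
  -- `hward : ∫ e^{sF}·(s·Y) = β · ∫ e^{sF}·F`
  have h1 : ∫ U, Real.exp (s * actionFlowDeriv c U) *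
        (s * ∑ p : Plaquette d L, (plaqCharge c p.1 p.2.1.1 p.2.1.2 : ℝ) ^ 2 *
          ((plaquetteHolonomy U p.1 p.2.1.1 p.2.1.2 : Circle) : ℂ).re) ∂(wilsonMeasure u1Rep β) =
      s * ∫ U, Real.exp (s * actionFlowDeriv c U) *
        (∑ p : Plaquette d L, (plaqCharge c p.1 p.2.1.1 p.2.1.2 : ℝ) ^ 2 *
          ((plaquetteHolonomy U p.1 p.2.1.1 p.2.1.2 : Circle) : ℂ).re) ∂(wilsonMeasure u1Rep β) := by
    rw [← integral_const_mul]
    refine integral_congr_ae (ae_of_all _ fun U => ?_)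
    ring
  have h2 : ∫ U, Real.exp (s * actionFlowDeriv c U) * actionFlowDeriv c U ∂(wilsonMeasure u1Rep β) =
      ∫ U, actionFlowDeriv c U * Real.exp (s * actionFlowDeriv c U) ∂(wilsonMeasure u1Rep β) := by
    refine integral_congr_ae (ae_of_all _ fun U => ?_)
    ring
  rw [← h1, hward, h2]

/-- ★★ **THE DIFFERENTIAL INEQUALITY** (rate `a = ‖dc‖²∕β`, defect `Δ = 0`, in the currency of the (α) letters): for `β > 0` and `s ≥ 0`,
`∫ F(dc)·e^{s·F(dc)} dμ_β ≤ ((‖dc‖²∕β)·s + 0) · ∫ e^{s·F(dc)} dμ_β`. [cite: GrossCMP1983, §4 p. 153] -/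
theorem integral_flux_mul_exp_le (c : Edge d L → ℤ) {β : ℝ} (hβ : 0 < β) {s : ℝ} (hs : 0 ≤ s) :
    ∫ U, actionFlowDeriv c U * Real.exp (s * actionFlowDeriv c U) * (1 : ℝ) ∂(wilsonMeasure u1Rep β) ≤
      ((∑ p : Plaquette d L, (plaqCharge c p.1 p.2.1.1 p.2.1.2 : ℝ) ^ 2) / β * s + 0) *
        ∫ U, Real.exp (s * actionFlowDeriv c U) * (1 : ℝ) ∂(wilsonMeasure u1Rep β) := by
  haveI := isProbabilityMeasure_wilsonMeasure (d := d) (L := L) u1Rep continuous_u1Rep β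
  simp only [mul_one, add_zero]
  have hX := continuous_actionFlowDeriv (d := d) (L := L) c
  have hY := continuous_sum_sq_mul_re (d := d) (L := L) c
  have hF : Continuous fun U : GaugeConfig d L Circle => Real.exp (s * actionFlowDeriv c U) :=
    Real.continuous_exp.comp (continuous_const.mul hX)
  -- integrability on the compact configuration torus (probability measure, continuous integrands)
  have hiF : Integrable (fun U => Real.exp (s * actionFlowDeriv c U)) (wilsonMeasure u1Rep β) :=
    hF.integrable_of_hasCompactSupport (HasCompactSupport.of_compactSpace _)
  have hiFY : Integrable (fun U => Real.exp (s * actionFlowDeriv c U) *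
      (∑ p : Plaquette d L, (plaqCharge c p.1 p.2.1.1 p.2.1.2 : ℝ) ^ 2 *
        ((plaquetteHolonomy U p.1 p.2.1.1 p.2.1.2 : Circle) : ℂ).re)) (wilsonMeasure u1Rep β) :=
    (hF.mul hY).integrable_of_hasCompactSupport (HasCompactSupport.of_compactSpace _)
  -- the pointwise bound `e^{sF}·Y ≤ ‖dc‖²·e^{sF}`
  have hpt : ∀ U : GaugeConfig d L Circle, Real.exp (s * actionFlowDeriv c U) *
      (∑ p : Plaquette d L, (plaqCharge c p.1 p.2.1.1 p.2.1.2 : ℝ) ^ 2 *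
        ((plaquetteHolonomy U p.1 p.2.1.1 p.2.1.2 : Circle) : ℂ).re) ≤
      (∑ p : Plaquette d L, (plaqCharge c p.1 p.2.1.1 p.2.1.2 : ℝ) ^ 2) * Real.exp (s * actionFlowDeriv c U) := fun U => by
    rw [mul_comm]
    exact mul_le_mul_of_nonneg_right (sum_sq_mul_re_le c U) (Real.exp_pos _).le
  have hle : ∫ U, Real.exp (s * actionFlowDeriv c U) *
      (∑ p : Plaquette d L, (plaqCharge c p.1 p.2.1.1 p.2.1.2 : ℝ) ^ 2 *
        ((plaquetteHolonomy U p.1 p.2.1.1 p.2.1.2 : Circle) : ℂ).re) ∂(wilsonMeasure u1Rep β) ≤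
      (∑ p : Plaquette d L, (plaqCharge c p.1 p.2.1.1 p.2.1.2 : ℝ) ^ 2) *
        ∫ U, Real.exp (s * actionFlowDeriv c U) ∂(wilsonMeasure u1Rep β) := by
    rw [← integral_const_mul]
    exact integral_mono hiFY (hiF.const_mul _) hpt
  have hid := integral_flux_mul_exp_eq (d := d) (L := L) c β s
  -- divide the identity by `β > 0`
  have : ∫ U, actionFlowDeriv c U * Real.exp (s * actionFlowDeriv c U) ∂(wilsonMeasure u1Rep β) =
      s / β * ∫ U, Real.exp (s * actionFlowDeriv c U) *
        (∑ p : Plaquette d L, (plaqCharge c p.1 p.2.1.1 p.2.1.2 : ℝ) ^ 2 *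
          ((plaquetteHolonomy U p.1 p.2.1.1 p.2.1.2 : Circle) : ℂ).re) ∂(wilsonMeasure u1Rep β) := by
    rw [div_mul_eq_mul_div]
    exact eq_div_of_mul_eq hβ.ne' (by rw [mul_comm]; exact hid)
  rw [this]
  calc s / β * ∫ U, Real.exp (s * actionFlowDeriv c U) *
        (∑ p : Plaquette d L, (plaqCharge c p.1 p.2.1.1 p.2.1.2 : ℝ) ^ 2 *
          ((plaquetteHolonomy U p.1 p.2.1.1 p.2.1.2 : Circle) : ℂ).re) ∂(wilsonMeasure u1Rep β)
      ≤ s / β * ((∑ p : Plaquette d L, (plaqCharge c p.1 p.2.1.1 p.2.1.2 : ℝ) ^ 2) *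
          ∫ U, Real.exp (s * actionFlowDeriv c U) ∂(wilsonMeasure u1Rep β)) :=
        mul_le_mul_of_nonneg_left hle (div_nonneg hs hβ.le)
    _ = (∑ p : Plaquette d L, (plaqCharge c p.1 p.2.1.1 p.2.1.2 : ℝ) ^ 2) / β * s *
          ∫ U, Real.exp (s * actionFlowDeriv c U) ∂(wilsonMeasure u1Rep β) := by ring

/-! ## §3 Gaussian domination of the flux MGF (Thm 2.2) and the sub-Gaussian tail -/

/-- The flux MGF for `s ≥ 0`: `∫ e^{s·F(dc)} dμ_β ≤ exp((‖dc‖²∕β)·s²∕2)` — Grönwall on §2 via the (α) letters. [cite: GrossCMP1983, Thm 2.2] -/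
theorem integral_exp_mul_flux_le_of_nonneg (c : Edge d L → ℤ) {β : ℝ} (hβ : 0 < β) {s : ℝ} (hs : 0 ≤ s) :
    ∫ U, Real.exp (s * actionFlowDeriv c U) ∂(wilsonMeasure u1Rep β) ≤
      Real.exp ((∑ p : Plaquette d L, (plaqCharge c p.1 p.2.1.1 p.2.1.2 : ℝ) ^ 2) / β * s ^ 2 / 2) := by
  haveI := isProbabilityMeasure_wilsonMeasure (d := d) (L := L) u1Rep continuous_u1Rep β
  have hXm : Measurable (actionFlowDeriv (d := d) (L := L) c) := (continuous_actionFlowDeriv c).measurable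
  have hXB := abs_actionFlowDeriv_le (d := d) (L := L) c
  have hχm : Measurable fun _ : GaugeConfig d L Circle => (1 : ℝ) := measurable_const
  have hχM : ∀ U : GaugeConfig d L Circle, |(1 : ℝ)| ≤ 1 := fun _ => by simp
  have hχ0 : ∀ U : GaugeConfig d L Circle, (0 : ℝ) ≤ 1 := fun _ => zero_le_one
  have hmass : 0 < ∫ U, (1 : ℝ) ∂(wilsonMeasure (d := d) (L := L) u1Rep β) := by simp
  have hgron := le_mul_exp_of_deriv_le_linear_mul_of_mem
    (ψ := fun s => ∫ U, Real.exp (s * actionFlowDeriv c U) * (1 : ℝ) ∂(wilsonMeasure u1Rep β))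
    (ψ' := fun s => ∫ U, actionFlowDeriv c U * Real.exp (s * actionFlowDeriv c U) * (1 : ℝ) ∂(wilsonMeasure u1Rep β))
    (a := (∑ p : Plaquette d L, (plaqCharge c p.1 p.2.1.1 p.2.1.2 : ℝ) ^ 2) / β) (Δ := 0) (T := s)
    (fun t _ => hasDerivAt_integral_exp_mul_weight (wilsonMeasure u1Rep β) hXm hχm hXB hχM t)
    (fun t _ => integral_exp_mul_weight_pos (wilsonMeasure u1Rep β) hXm hχm hXB hχM hχ0 hmass t)
    (fun t ht => integral_flux_mul_exp_le c hβ ht.1) (s := s) ⟨hs, le_rfl⟩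
  simp only [zero_mul, mul_one, Real.exp_zero, integral_const, probReal_univ, smul_eq_mul, one_mul,
    add_zero] at hgron
  exact hgron

/-- ★★★ **GROSS'S GAUSSIAN DOMINATION (CMP 92 Thm 2.2), WILSON `U(1)` ON THE TORUS.** For every `β > 0`, every integer 1-cochain `c` on
the torus `(ℤ∕L)^d` and every real `s`:
`∫ exp(s·F(dc)) dμ_β ≤ exp(s²·‖dc‖²∕(2β))`, `F(dc) = Σ_p (dc)_p sin θ_p = actionFlowDeriv c`, `‖dc‖² = Σ_p (plaqCharge c p)²` — the flux of an
EXACT 2-cochain is sub-Gaussian with the free (lattice-Maxwell) variance proxy, at every coupling and volume, with no expansion, no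
duality, no reflection positivity. [cite: GrossCMP1983, Thm 2.2] -/
theorem integral_exp_mul_flux_le (c : Edge d L → ℤ) {β : ℝ} (hβ : 0 < β) (s : ℝ) :
    ∫ U, Real.exp (s * actionFlowDeriv c U) ∂(wilsonMeasure u1Rep β) ≤
      Real.exp (s ^ 2 * (∑ p : Plaquette d L, (plaqCharge c p.1 p.2.1.1 p.2.1.2 : ℝ) ^ 2) / (2 * β)) := by
  rcases le_total 0 s with hs | hs
  · refine (integral_exp_mul_flux_le_of_nonneg c hβ hs).trans_eq ?_
    congr 1; field_simp
  · -- `s ≤ 0`: apply the nonnegative case to `−c` at `−s`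
    have h := integral_exp_mul_flux_le_of_nonneg (d := d) (L := L) (-c) hβ (s := -s) (by linarith)
    simp only [actionFlowDeriv_neg, mul_neg, neg_mul, neg_neg, plaqCharge_neg, Int.cast_neg, even_two, Even.neg_pow]
      at h
    refine h.trans_eq ?_
    congr 1; field_simp

/-- The same in the `wilsonExpectation` letter: `⟨e^{s·F(dc)}⟩_β ≤ exp(s²‖dc‖²∕(2β))`. [cite: GrossCMP1983, Thm 2.2] -/
theorem wilsonExpectation_exp_mul_flux_le (c : Edge d L → ℤ) {β : ℝ} (hβ : 0 < β) (s : ℝ) :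
    wilsonExpectation u1Rep β (fun U => Real.exp (s * actionFlowDeriv c U)) ≤
      Real.exp (s ^ 2 * (∑ p : Plaquette d L, (plaqCharge c p.1 p.2.1.1 p.2.1.2 : ℝ) ^ 2) / (2 * β)) :=
  integral_exp_mul_flux_le c hβ s

/-- ★ **THE SUB-GAUSSIAN FLUX TAIL** (Chernoff on Thm 2.2, via (α)'s `measureReal_le_of_gronwall`): for `β > 0`, `s ≥ 0` and any `θ`,
`μ_β{θ ≤ F(dc)} ≤ exp(−s·θ + (‖dc‖²∕β)·s²∕2)`. [cite: GrossCMP1983, Thm 2.2 (consequence)] -/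
theorem measureReal_flux_ge_le (c : Edge d L → ℤ) {β : ℝ} (hβ : 0 < β) {s : ℝ} (hs : 0 ≤ s) (θ : ℝ) :
    (wilsonMeasure (d := d) (L := L) u1Rep β).real {U | θ ≤ actionFlowDeriv c U} ≤
      Real.exp (-(s * θ) + (∑ p : Plaquette d L, (plaqCharge c p.1 p.2.1.1 p.2.1.2 : ℝ) ^ 2) / β * s ^ 2 / 2) := by
  haveI := isProbabilityMeasure_wilsonMeasure (d := d) (L := L) u1Rep continuous_u1Rep β
  have hXm : Measurable (actionFlowDeriv (d := d) (L := L) c) := (continuous_actionFlowDeriv c).measurable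
  have hXB := abs_actionFlowDeriv_le (d := d) (L := L) c
  have hχm : Measurable fun _ : GaugeConfig d L Circle => (1 : ℝ) := measurable_const
  have hχM : ∀ U : GaugeConfig d L Circle, |(1 : ℝ)| ≤ 1 := fun _ => by simp
  have hχ0 : ∀ U : GaugeConfig d L Circle, (0 : ℝ) ≤ 1 := fun _ => zero_le_one
  have hmass : 0 < ∫ U, (1 : ℝ) ∂(wilsonMeasure (d := d) (L := L) u1Rep β) := by simp
  have h := measureReal_le_of_gronwall (wilsonMeasure u1Rep β) hXm hχm hXB hχM hχ0 hmass hs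
    (a := (∑ p : Plaquette d L, (plaqCharge c p.1 p.2.1.1 p.2.1.2 : ℝ) ^ 2) / β) (Δ := 0)
    (fun t ht => integral_flux_mul_exp_le c hβ ht.1) θ
  simp only [and_true, integral_const, probReal_univ, smul_eq_mul, one_mul, zero_mul, add_zero] at h
  exact h

/-- ★ The optimised tail: for `β > 0`, `θ ≥ 0` and `dc ≠ 0`, `μ_β{θ ≤ F(dc)} ≤ exp(−β·θ²∕(2‖dc‖²))` (take `s = βθ∕‖dc‖²`).
[cite: GrossCMP1983, Thm 2.2 (consequence)] -/
theorem measureReal_flux_ge_le_opt (c : Edge d L → ℤ) {β : ℝ} (hβ : 0 < β) {θ : ℝ} (hθ : 0 ≤ θ)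
    (hN : 0 < ∑ p : Plaquette d L, (plaqCharge c p.1 p.2.1.1 p.2.1.2 : ℝ) ^ 2) :
    (wilsonMeasure (d := d) (L := L) u1Rep β).real {U | θ ≤ actionFlowDeriv c U} ≤
      Real.exp (-(β * θ ^ 2 / (2 * ∑ p : Plaquette d L, (plaqCharge c p.1 p.2.1.1 p.2.1.2 : ℝ) ^ 2))) := by
  set N : ℝ := ∑ p : Plaquette d L, (plaqCharge c p.1 p.2.1.1 p.2.1.2 : ℝ) ^ 2 with hNdef
  have hs : 0 ≤ β * θ / N := div_nonneg (mul_nonneg hβ.le hθ) hN.le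
  refine (measureReal_flux_ge_le c hβ hs θ).trans_eq ?_
  congr 1
  field_simp
  ring

/-! ## §4 The free variance bound (`t → 0⁺` end, via the (β) letters) -/

/-- ★★ **THE FREE (LATTICE-MAXWELL) VARIANCE BOUND FOR EXACT FLUXES.** For every `β > 0` and every integer 1-cochain `c`:
`∫ F(dc)² dμ_β ≤ ‖dc‖²∕β` — the second moment of the flux of an exact 2-cochain is dominated by its massless free-field value,
from Thm 2.2 for `F(dc)` AND `F(d(−c)) = −F(dc)` at small `t` via ym3-torus-px9 g9's (β) `integral_sq_mul_weight_le_of_subgaussian_mgf_nhds`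
BY NAME.  This is the abelian shape of LINE 28's target «BlockSecondMomentL» (`E dist₁² ≤ C·g²`). [cite: GrossCMP1983, Thm 2.2 + Thm 2.5 I (n = 1)] -/
theorem integral_flux_sq_le (c : Edge d L → ℤ) {β : ℝ} (hβ : 0 < β) :
    ∫ U, actionFlowDeriv c U ^ 2 ∂(wilsonMeasure u1Rep β) ≤
      (∑ p : Plaquette d L, (plaqCharge c p.1 p.2.1.1 p.2.1.2 : ℝ) ^ 2) / β := by
  haveI := isProbabilityMeasure_wilsonMeasure (d := d) (L := L) u1Rep continuous_u1Rep β
  have hXm : Measurable (actionFlowDeriv (d := d) (L := L) c) := (continuous_actionFlowDeriv c).measurable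
  have hXB := abs_actionFlowDeriv_le (d := d) (L := L) c
  have hχm : Measurable fun _ : GaugeConfig d L Circle => (1 : ℝ) := measurable_const
  have hχ0 : ∀ U : GaugeConfig d L Circle, (0 : ℝ) ≤ 1 := fun _ => zero_le_one
  have hχM : ∀ U : GaugeConfig d L Circle, (1 : ℝ) ≤ 1 := fun _ => le_rfl
  have hN : 0 ≤ (∑ p : Plaquette d L, (plaqCharge c p.1 p.2.1.1 p.2.1.2 : ℝ) ^ 2) / β :=
    div_nonneg (Finset.sum_nonneg fun p _ => sq_nonneg _) hβ.le
  have key := integral_sq_mul_weight_le_of_subgaussian_mgf_nhds (wilsonMeasure u1Rep β) hXm hχm hXB hχ0 hχM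
    one_pos hN (T := 1) (a := (∑ p : Plaquette d L, (plaqCharge c p.1 p.2.1.1 p.2.1.2 : ℝ) ^ 2) / β) ?_ ?_
  · simpa only [mul_one, integral_const, probReal_univ, smul_eq_mul] using key
  · intro t _
    have h := integral_exp_mul_flux_le (d := d) (L := L) c hβ t
    simp only [mul_one, integral_const, probReal_univ, smul_eq_mul, one_mul]
    refine h.trans_eq ?_
    congr 1; field_simp
  · intro t _
    have h := integral_exp_mul_flux_le (d := d) (L := L) c hβ (-t)
    simp only [mul_one, integral_const, probReal_univ, smul_eq_mul, one_mul]
    refine (le_of_eq_of_le ?_ h).trans_eq ?_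
    · refine integral_congr_ae (ae_of_all _ fun U => ?_); ring_nf
    · congr 1; field_simp

/-- The same in the `wilsonExpectation` letter: `⟨F(dc)²⟩_β ≤ ‖dc‖²∕β`. [cite: GrossCMP1983, Thm 2.5 I (n = 1)] -/
theorem wilsonExpectation_flux_sq_le (c : Edge d L → ℤ) {β : ℝ} (hβ : 0 < β) :
    wilsonExpectation u1Rep β (fun U => actionFlowDeriv c U ^ 2) ≤
      (∑ p : Plaquette d L, (plaqCharge c p.1 p.2.1.1 p.2.1.2 : ℝ) ^ 2) / β :=
  integral_flux_sq_le c hβ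

end Torus

end Summit.QuantumFields.YangMills.Theorems.U1TorusFluxGaussianDomination

end
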